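import Summits.QuantumFields.BalabanUV.Beta.D1BFx.RoadEndBFxTotalShell
import Summits.QuantumFields.BalabanUV.Beta.D1BFx.RestTotalOfGroups

/-!
# Road BF-x, THE DEBT END OF RECORD (total-rest form, shell currency, d0∕d1 and the (α)-leaf from the printed statements) FED BY ONE BOUND PER
# IDENTITY-CLOSED GROUP OF REST WORDS — owner SPEC «K-END-RESHAPE-GROUPS» v1 §3 (F2), road «BF-x», BINDER-OWNERS row D1

HONEST DEPENDENCY (page 1, mandatory): continuum YM on T⁴ ⇐ BetaPertH ∧ nine spine estimates (0/9 proved); BetaPertH ⇐ (D1) ∧ (D4) ∧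
CAP+tail; G-an2-4 gates asym, D1 and NE2/3/4.  HONEST FRAMING (cell contract, verbatim): «discharging `BetaPertH` makes Bałaban's UV
stability UNCONDITIONAL — a real constructive-QFT result; it is NOT the continuum limit and NOT the Clay problem.»  THIS MODULE DISCHARGES
NOTHING of the wall: [folklore] composition BY NAME of leaf-03-g5's `RoadEndBFxTotalShell.d1Drift_BFx_total_shell_of_prop12` (p228378 §2) with the
group glue `RestTotalOfGroups.hRestTot_of_hGroups` ((F1) of the same SPEC), the glue's (α)-leaf input `Spr (Ga n a)` supplied, as in p228378 §3, by
`GluonLegTails.hGa_of_prop12` from the two PRINTED statements `B5.Prop12Printed`∕`B5.Kernel126_127Printed` taken BY NAME as `h12`∕`h126` (hypotheses,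
NOT proved here; no `Prop` minted).  It is the APPEND-FREE twin of p228378 §3 `…_of_perWord` with the per-word (REST′) family replaced by ONE n-uniform
bound per group `g ≠ g₀` of a label `grp : RestIdx → G` whose fibre `g₀` is exactly the corner; `CRtot := Σ_{g ≠ g₀} CG g`.  Nothing of p228378 ∕ p226684
is touched.  WHY: SPEC §1 — the Λ⊗E words and the needle words are bounded only as GROUP sums (identities (I)(II) + LG letters; Ward cancellation),
so the END must take one hypothesis per identity-closed group; with SPEC §2's label `grp : RestIdx → Fin 4` (`G := Fin 4`, `g₀ := 3` the corner) the
road's (Λ) and (N) rows become the hypotheses `hGrp n hn 1 _` and `hGrp n hn 2 _` of the theorem below, the LOCAL words `hGrp n hn 0 _`.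
DISPLAYED DEBT OF ROAD BF-x AFTER THIS FILE, BY NAME (unchanged from p228378 §2 but for the rest row): bridge B1 (`hB1`); (K) `hK` + `hω` + `hlam`; the
five slot-table sockets; `hdiv`; `hrowgh`; the SHELL rows `h2s`∕`d2s` of `gfrz`; the GROUP bounds `hGrp` (with the partition datum `hcorner`); (U); and
the two PRINTED statements `h12`∕`h126`.  0 sorry; 0 wall binders (hW∕hR∕D1Tel∕D1Rep = 0∕4); (K) NOT closed; NOT D1, NOT `BetaPertH`, NOT continuum,
NOT Clay.

ABSOLUTE RULE (cell charter, verbatim): «No internally-minted statement may enter as a cited fact. Every hypothesis is either kernel-proved in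
this package or a verbatim quotation of a PUBLISHED theorem with page reference. The manuscript(s) under audit are NOT citable for their own
disputed steps — they are the thing under adjudication; programme-internal (2001/route/tribunal) claims are never citable.»

Unit `b2b-balaban-gan24-formalise-leaf-05` (gen 40), G-an2-4 swarm leaf prover on cross-lane kernel duty for road «BF-x» (SPEC §4: first refusal
leaf-03 lineage, else gan24-leaf-05 lineage); `LEAVES-BFx.md` sub-row «TOTAL-SHELL-GROUPS».
-/

noncomputable section

open Finset Filter Topology
open Literature.Probability.LatticeModels (annulus)
open scoped BigOperators
open Literature.MathematicalPhysics.QuantumFieldTheory.Balaban1983to89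
open Literature.MathematicalPhysics.QuantumFieldTheory.Balaban1983to89.Beta
open OneStepResolventKernel (JetData)
open OneStepKernelFamily (TbalOf D1Drift)
open WindowIdentification (fullSum psum)
open DyadicShell (Pt toReal supNorm)
open ExpKernelCalculus (Site MKer BiLoc shiftK)
open GhostTable (gFree)
open BubbleTransfer (unitVec)
open DressedMomentNormalisation (resSite)
open Summit.QuantumFields.BalabanUV.Beta.D1BFx.ReducedKernel (TableR TOfRed)
open Summit.QuantumFields.BalabanUV.Beta.D1BFx.DressedTadpoleTable (tableRed)
open Summit.QuantumFields.BalabanUV.Beta.D1BFx.ReducedKernelSandwich (fineHess)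
open Summit.QuantumFields.BalabanUV.Beta.D1BFx.FineStencilBFBalaban (SbfBal)
open Summit.QuantumFields.BalabanUV.Beta.D1BFx.SecondStencilBF (Wbf)
open Summit.QuantumFields.BalabanUV.Beta.D1BFx.GhostKernelComplete (PghQ fineHessGhQ)
open Summit.QuantumFields.BalabanUV.Beta.D1BFx.FrozenLegProfile (gfrz)
open Summit.QuantumFields.BalabanUV.Beta.D1BFx.SplitInstance (RestIdx)
open Summit.QuantumFields.BalabanUV.Beta.D1BFx.SplitRecut (restK')
open Summit.QuantumFields.BalabanUV.Beta.D1BFx.RoadEndBFxRecut (cornerIdx)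
open Summit.QuantumFields.BalabanUV.Beta.D1BFx.RoadEndBFxTotalShell (d1Drift_BFx_total_shell_of_prop12)
open Summit.QuantumFields.BalabanUV.Beta.D1BFx.RestTotalOfGroups (hRestTot_of_hGroups)
open Summit.QuantumFields.BalabanUV.Beta.D1BFx.FrozenLegTails (nOf MOf hn1)
open Summit.QuantumFields.BalabanUV.Beta.D1BFx.GluonLegTails (hGa_of_prop12)
open VectorTailsLoc (fam kfam)

namespace Summit.QuantumFields.BalabanUV.Beta.D1BFx.RoadEndBFxTotalShellGroups

variable {Lc : ℕ} [NeZero Lc] {a N : ℝ} {μ ν : Fin 4} {υ : Type*} [Fintype υ]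
  {cE cVH cΛ cR cK cQ cE₂ cJ4 cΛ₂ cR₂ cQ₂ x₀ ωgl ωgh : ℕ → ℝ} {WE WJ WΛ WR WQ : ℕ → TableR} {CE CJ CΛ CRt CQ δW : ℕ → ℝ}
  {Ru : υ → ℕ → ℝ} {CU : υ → ℝ} {D₂ U₁ : ℝ} {G : Type*} [Fintype G] [DecidableEq G] {grp : RestIdx → G} {g₀ : G} {CG : G → ℝ}

/-- [folklore] **ROAD BF-x, THE DEBT END FED BY GROUP REST BOUNDS**: `RoadEndBFxTotalShell.d1Drift_BFx_total_shell_of_prop12` with `hRestTot` supplied by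
`RestTotalOfGroups.hRestTot_of_hGroups` from ONE n-uniform bound `CG g` per group `g ≠ g₀` of a label `grp : RestIdx → G` of the rest words whose fibre `g₀`
is exactly the corner (`hcorner`), `CRtot := Σ_{g ≠ g₀} CG g`; the glue's (α)-leaf input is `GluonLegTails.hGa_of_prop12`.  Displayed: B1, (K), sockets,
`hdiv`, `hrowgh`, shell rows h2s∕d2s, the partition datum `hcorner`, ONE bound per group `hGrp`, (U), `h12`∕`h126`. -/
theorem d1Drift_BFx_total_shell_of_prop12_of_groups (Js : ℕ → JetData 3 Lc) (hμν : μ ≠ ν) (hN : N ≠ 0) (hL : 2 ≤ Lc) (hodd : Odd Lc)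
    (ha : 0 < a) (c : ℕ → ℝ) {A₂ δ₂ : ℝ} (hD₂ : 0 ≤ D₂) (hA₂ : 0 ≤ A₂) (hδ₂ : 0 < δ₂)
    -- the two PRINTED statements, by name, for the family scale × even cubic volumes
    (h12 : B5.Prop12Printed (fam nOf hn1 MOf a ha)) (h126 : B5.Kernel126_127Printed (kfam nOf MOf))
    -- the frozen profile's same-leg second differences, SHELL currency
    (h2s : ∀ n : ℕ, 2 ≤ n → ∀ [NeZero n], ∀ b ∈ (univ : Finset (Fin 4 → Fin n)).image resSite, ∀ r : ℕ, r + 1 ≤ n →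
      ∑ v ∈ annulus 4 r (r + 1), |(gfrz n a b (v + unitVec ν + unitVec μ) - gFree (v + unitVec ν + unitVec μ)) -
          (gfrz n a b (v + unitVec ν) - gFree (v + unitVec ν)) - (gfrz n a b (v + unitVec μ) - gFree (v + unitVec μ)) +
          (gfrz n a b v - gFree v)| ≤ D₂ / (n : ℝ))
    (d2s : ∀ n : ℕ, 2 ≤ n → ∀ [NeZero n], ∀ b ∈ (univ : Finset (Fin 4 → Fin n)).image resSite, ∀ r : ℕ, n ≤ r →
      ∑ v ∈ annulus 4 r (r + 1), |gfrz n a b (v + unitVec ν + unitVec μ) - gfrz n a b (v + unitVec ν) - gfrz n a b (v + unitVec μ) + gfrz n a b v| ≤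
        A₂ * Real.exp (-(δ₂ / n) * ((r : ℝ) + 1)) / ((r : ℝ) + 1))
    -- bridge B1
    (hB1 : ∀ m : ℕ, 1 ≤ m → |(∑ j ∈ range m, B12Beta.secondMoment (TbalOf Lc Js j) μ ν) - c (Lc ^ m)| ≤ U₁)
    -- slot (K) with the loop-weight ratio and the PINNED normalisation
    (hK : ∀ n : ℕ, 2 ≤ n → Odd n → ∀ [NeZero n], c n =
      ωgl n * B12Beta.secondMoment (TOfRed n a (SbfBal n a (cE n) (cVH n) (cΛ n) (cR n) (cK n) (cQ n))
        (tableRed n (Wbf (cE₂ n) (cJ4 n) (cΛ₂ n) (cR₂ n) (cQ₂ n) (WE n) (WJ n) (WΛ n) (WR n) (WQ n)))) μ ν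
      + ωgh n * B12Beta.secondMoment (PghQ n a (x₀ n) (cK n) (cQ n)) μ ν + ∑ u, Ru u n)
    (hω : ∀ n : ℕ, 2 ≤ n → ωgh n * cK n ^ 2 = -2 * (ωgl n * cE n ^ 2)) (hlam : ∀ n : ℕ, 2 ≤ n → ωgl n * cE n ^ 2 = 2 * N ^ 2 * (n : ℝ) ^ 8)
    -- slot-table sockets
    (hδW : ∀ n, 0 < δW n)
    (hE : ∀ n κ u l u', BiLoc (WE n κ u l u') u u' (CE n) (δW n)) (hJ : ∀ n κ u l u', BiLoc (WJ n κ u l u') u u' (CJ n) (δW n))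
    (hΛ : ∀ n κ u l u', BiLoc (WΛ n κ u l u') u u' (CΛ n) (δW n)) (hR : ∀ n κ u l u', BiLoc (WR n κ u l u') u u' (CRt n) (δW n))
    (hQ : ∀ n κ u l u', BiLoc (WQ n κ u l u') u u' (CQ n) (δW n))
    (hEc : ∀ (n : ℕ) (κ : Fin 4) (u : Site 4) (l : Fin 4) (u' t : Site 4),
      WE n κ (u + (n : ℤ) • t) l (u' + (n : ℤ) • t) = shiftK (-((n : ℤ) • t)) (WE n κ u l u'))
    (hJc : ∀ (n : ℕ) (κ : Fin 4) (u : Site 4) (l : Fin 4) (u' t : Site 4),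
      WJ n κ (u + (n : ℤ) • t) l (u' + (n : ℤ) • t) = shiftK (-((n : ℤ) • t)) (WJ n κ u l u'))
    (hΛc : ∀ (n : ℕ) (κ : Fin 4) (u : Site 4) (l : Fin 4) (u' t : Site 4),
      WΛ n κ (u + (n : ℤ) • t) l (u' + (n : ℤ) • t) = shiftK (-((n : ℤ) • t)) (WΛ n κ u l u'))
    (hRc : ∀ (n : ℕ) (κ : Fin 4) (u : Site 4) (l : Fin 4) (u' t : Site 4),
      WR n κ (u + (n : ℤ) • t) l (u' + (n : ℤ) • t) = shiftK (-((n : ℤ) • t)) (WR n κ u l u'))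
    (hQc : ∀ (n : ℕ) (κ : Fin 4) (u : Site 4) (l : Fin 4) (u' t : Site 4),
      WQ n κ (u + (n : ℤ) • t) l (u' + (n : ℤ) • t) = shiftK (-((n : ℤ) • t)) (WQ n κ u l u'))
    (hEs : ∀ n κ u l u', WE n κ u l u' = WE n l u' κ u) (hJs : ∀ n κ u l u', WJ n κ u l u' = WJ n l u' κ u)
    (hΛs : ∀ n κ u l u', WΛ n κ u l u' = WΛ n l u' κ u) (hRs : ∀ n κ u l u', WR n κ u l u' = WR n l u' κ u)
    (hQs : ∀ n κ u l u', WQ n κ u l u' = WQ n l u' κ u)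
    -- first-bond divergence-freeness of the gluon fine Hessian kernel; the ghost Ward rows
    (hdiv : ∀ n : ℕ, 2 ≤ n → ∀ [NeZero n], ∀ (l' : Fin 4) (u' u : Site 4), ∑ κ' : Fin 4,
      (fineHess n a (SbfBal n a (cE n) (cVH n) (cΛ n) (cR n) (cK n) (cQ n))
          (Wbf (cE₂ n) (cJ4 n) (cΛ₂ n) (cR₂ n) (cQ₂ n) (WE n) (WJ n) (WΛ n) (WR n) (WQ n)) κ' l' (u - Pi.single κ' 1) u'
        - fineHess n a (SbfBal n a (cE n) (cVH n) (cΛ n) (cR n) (cK n) (cQ n))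
          (Wbf (cE₂ n) (cJ4 n) (cΛ₂ n) (cR₂ n) (cQ₂ n) (WE n) (WJ n) (WΛ n) (WR n) (WQ n)) κ' l' u u') = 0)
    (hrowgh : ∀ n : ℕ, 2 ≤ n → ∀ [NeZero n], ∀ (κ' l' : Fin 4) (b : Site 4), HasSum (fineHessGhQ n a (x₀ n) (cK n) (cQ n) κ' l' b) 0)
    -- (REST-GROUPS): the rest words labelled by `grp`, the corner exactly the fibre of `g₀`; ONE n-UNIFORM bound per group `g ≠ g₀`; (U)
    (hcorner : ∀ τ : RestIdx, grp τ = g₀ ↔ τ = cornerIdx)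
    (hGrp : ∀ n : ℕ, 2 ≤ n → ∀ [NeZero n], ∀ g : G, g ≠ g₀ →
      |∑ b ∈ (univ : Finset (Fin 4 → Fin n)).image resSite, ((n : ℝ) ^ 4)⁻¹ *
        fullSum (fun w : Pt => ∑ τ ∈ (univ : Finset RestIdx).filter (fun τ => grp τ = g),
          restK' n a (gfrz n a b) (cE n) (cΛ n) (cR n) (cK n) (cQ n) (cE₂ n) (cJ4 n) (cΛ₂ n) (cR₂ n) (cQ₂ n) (x₀ n)
            (WE n) (WJ n) (WΛ n) (WR n) (WQ n) (ωgl n) (ωgh n) ((n : ℝ) ^ 8) N μ ν b τ w)| ≤ CG g)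
    (hU : ∀ n : ℕ, 2 ≤ n → ∀ u, |Ru u n| ≤ CU u) :
    D1Drift Lc Js N μ ν :=
  d1Drift_BFx_total_shell_of_prop12 Js hμν hN hL hodd ha c hD₂ hA₂ hδ₂ h12 h126 h2s d2s hB1 hK hω hlam hδW hE hJ hΛ hR hQ hEc hJc hΛc hRc hQc
    hEs hJs hΛs hRs hQs hdiv hrowgh
    (hRestTot_of_hGroups ha hμν (hGa_of_prop12 ha h12 h126) hδW hE hJ hΛ hR hQ hcorner hGrp) hU

end Summit.QuantumFields.BalabanUV.Beta.D1BFx.RoadEndBFxTotalShellGroups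

end
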